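import Mathlib
import HarnessLib
import Summits.NavierStokesRegularity.NavierStokesRegularity.Theses.PoloidalWindowDoor
import Summits.NavierStokesRegularity.NavierStokesRegularity.Theorems.PoloidalWindowDoorLrcModEntireFarThreadReduction
import Summits.NavierStokesRegularity.NavierStokesRegularity.Theorems.PoloidalWindowDoorLrcModEntireFarThreadSplit
import Summits.NavierStokesRegularity.NavierStokesRegularity.Theorems.LoopPeriodRatchetNoLoopsOfGrowth
import Summits.NavierStokesRegularity.NavierStokesRegularity.Theorems.LoopPeriodRatchetPeriodScalingBound
import Summits.NavierStokesRegularity.NavierStokesRegularity.Theorems.PoloidalWindowDoorPoloidalWindowRigidityHotLoopsIslandOrNull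
import Summits.NavierStokesRegularity.NavierStokesRegularity.Theorems.PoloidalWindowDoorPoloidalWindowRigidityHotLoopsIslandsPersist
import Summits.NavierStokesRegularity.NavierStokesRegularity.Theorems.PoloidalWindowDoorPoloidalWindowRigidityHotLoopsNullRigidity
import Summits.NavierStokesRegularity.NavierStokesRegularity.Theorems.PoloidalWindowDoorPoloidalWindowRigidityHotLoopsNullRigidityPinFree

/-!
# SKELETON `hot_loops` v4.3 — crux `PoloidalWindowRigidity` (K2, stmt-NavierStokesRegularity-19708; concludes ALSO the promoted item
# `LrcModEntire`, stmt-NavierStokesRegularity-20428), route `PoloidalWindowDoor`, THICK column AT THE HOT SET — ideator seat ns-idea-8 gen 6,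
# LINE 13 (lens «barrier» = barrier-inversion; files-only per KEY-NS #68/#69: NOT the skeleton of record; the K2 leads decide adoption).
# No summit is proved by any line.

**v4.3 (hygiene, 2026-08-28T21:0xZ; stub STATEMENTS unchanged): the last provable stub HP4″ `stub_nullRigidity` (pin-free) is DISCHARGED BY NAME from the landed
`Theorems/PoloidalWindowDoorPoloidalWindowRigidityHotLoopsNullRigidityPinFree.lean` (p665858, K2-p2 g11; VERBATIM statement).  Sorries 4 → 3 = {S0 (VERBATIM shared research stub),
S6G (= item 27893 BY NAME), HL3′ (own typed residue)} — NO provable stub is left on this line.  The K2 hands have ALSO landed the line's compositions as sorry-free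
CONDITIONAL theorems: `Theorems/…HotLoopsReduction.lean` (p666322: `zero_of_island (hG)`, `threadedThickEmpty_of_growth_of_peakless (hG) (hHL3)`,
`lrcModEntire_of_NUGRS_of_growth_of_peakless`, `poloidalWindowRigidity_of_NUGRS_of_growth_of_peakless (hS0) (hG) (hHL3)`, `planarExtremumLiouville_of_growth_of_peakless (hG) (hPL)`)
and the first typed content of HL3′ modulo 27893: `Theorems/…HotLoopsPeakless.lean` (#22: the pinned hot set `{y₂ = 0, v₂(−1,y) = N}` has no compact isolated piece, is
UNBOUNDED and PERFECT).  IN THE TREE, kernel-checked: 19708 / 20428 ⇐ S0 ∧ 27893 ∧ HL3′ on this line.  Nothing is closed; no summit is proved.**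

**v4.2 (hygiene + alignment with the K2-p2 landings of 20:17–20:27Z; stub STATEMENTS unchanged from v4/v4.1 abbfbfc771e8): HP1 `stub_islandOrNull` and HP3′
`stub_islandsPersist` are now DISCHARGED BY NAME from the landed `Theorems/PoloidalWindowDoorPoloidalWindowRigidityHotLoopsIslandOrNull.lean` (p664413) and
`…HotLoopsIslandsPersist.lean` (p664434); the S3 composition uses the landed PINNED null rigidity `…HotLoopsNullRigidity.stub_nullRigidity` (p664456 = v3's HP4′
VERBATIM) BY NAME through the kernel-checked `nullWindow_of_island`; the pin-free HP4″ `stub_nullRigidity` (v4 statement VERBATIM) remains a stub used ONLY by the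
exported `zero_of_island` and the 22881 offer.  Sorries 6 → 4 = {S0, S6G (= item 27893 by name), HP4″, HL3′}.  CONSEQUENCE OF RECORD: on this line the S3 stub of the
threaded THICK column (`threadedThickEmpty_of_hotLoops`) now rests on the WALL item 27893 + the ONE typed residue HL3′ and on nothing else unlanded; item 20428 additionally on S0.
(Landed for v2, superseded as statements, corollaries of the landed HP3′ / HP4′: p662537 `…HotLoopsNearbyIslands`, p662470 `…HotLoopsSlabNullRigidity` — they pay no v4 stub.)**

**v4.1 = v4 (396635ef936a) + the OFFER block (`PeaklessLiouville`, `planarExtremumLiouville_of_peakless`; no new stub, all stub statements unchanged).  v4 SUPERSEDES v3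
(0f94a48b7886), v2 (703188a10903) and v1 (8d7db897cf6b).  v3 → v4 delta: the null-rigidity stub is now PIN-FREE — HP4″
`stub_nullRigidity` concludes `v ≡ 0` on `(−∞,0) × ℝ³` from null patches near any `(s₀, P_{z₁})` using Type-I decay as `t → −∞` instead of the pin (statements of
HP1 / HP3′ / HL3′ / S0 / S6G unchanged) — and the skeleton EXPORTS the pin-free, S3-free corollary `zero_of_island` : `FrequencyGrowthExponent →` [class e₃-poloidal
profile with an island bracket anywhere] `→ v ≡ 0` (modulo the three provable stubs), i.e. **modulo item 27893 every non-zero class poloidal Type-I ancient mild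
profile is PEAKLESS** — offered BY NAME to the custodians of 27893 / 22881 (`LoopPeriodRatchet.PlanarExtremumLiouville`, whose hypothesis world «ψ without strict
planar extrema» thereby also carries «v₂ without islands»).  v3: the lever exploited everywhere (HP3′/HP4′ near any `(s₀, P_{z₁})`, residue HL3′ PEAKLESS: modulo
the wall, `±v₂(s,·)|_{P_{z₀}}` has NO isolated compact strict-local-maximum piece on ANY plane at ANY time).**  v1 cut S3 into [HL1 loop around a NULL-FREE compact hot piece ∧ S6G] | HL2 null-touch | HL3 spread.  v2 replaced the level function: not `v₂` but
the planar STREAM FUNCTION `ψ` of the horizontal vorticity (`ωₕ = J∇ₕψ`, tree `exists_clebsch_slice`), which the frozen law makes CONSTANT ON EVERY REGULAR LEVEL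
CURVE OF `v₂` (`{v₂, ψ} = ∓ ω·∇v₂ = 0`).  Consequence (HP1, provable, unchanged since v2): around ANY isolated compact piece of a planar strict-local-maximum set
of `σv₂(s,·)` — null-free or not — EITHER `ψ` is non-constant on the `v₂`-superlevel continuum `C`, and then a regular value of `ψ` strictly between its extrema
and off the finitely many boundary constants cuts out a COMPACT REGULAR LEVEL CURVE OF `ψ` = a non-stationary closed vortex line (regular `ψ`-levels carry
`ω ≠ 0` by definition), OR `ψ` is constant on `C` and the plane is IRROTATIONAL on an open patch.  The first alternative is the wall's (S6G ⇒ no loops at any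
time); the second PROPAGATES AND IS RIGID: the island hypotheses persist on every nearby plane at every nearby time (HP3′: the planar-collar maximum set of
`σv₂(s,·)|_{P_{z₀}}` is again an isolated compact strict-local-maximum piece, by continuity — no pin, no global maximality needed), so modulo S6G every plane
`P_{z₀}`, `|z₀ − z₁| < δ`, is irrotational on a patch at every time `|s − s₀| < δ`; joint real-analyticity of class solutions (tree, PROVED:
`…ProfileAlignedWindowRigidityAncient.analyticOnNhd_uncurry` + `bdd_of_hasTypeITimeDecay`) spreads the patch to the plane, the planes to the slab, the slab to
`ℝ³`: `ω(s,·) ≡ 0` for `|s − s₀| < δ`, so `v(s,·)` is a bounded harmonic field, i.e. CONSTANT (tree `isConst_of_harmonic_bounded_inner`), the mild identity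
(`heatExtension_const`, `integral_oseenKernel_eq_zero`) makes the constant time-independent on the interval, TIME-ANALYTICITY makes `v` constant on all of
`(−∞,0) × ℝ³`, and Type-I decay `‖c‖ ≤ C/√(−t) → 0` (`t → −∞`) forces `c = 0`: `v ≡ 0` (HP4″, pin-free); for the pinned profile of S3 this contradicts
`N = v₂(−1,0) ≠ 0`.  Hence: **modulo the single wall item 27893 and three provable lemmas, every non-zero class poloidal profile — in particular the pinned
profile — is PEAKLESS — no horizontal plane, at no time, carries an isolated compact strict-local-extremum piece of `v₂`** (exported pin-free as `zero_of_island`);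
in particular the whole «isolated compact hot piece» world of v2 (isolated threads of every jet type incl. centre_type Z3 and all of I2, compact hot arcs, v1's
HL2) is empty, and so is every configuration with a strict local peak or pit of `v₂` on some plane at some time, anywhere in space.  The ONLY residue of the
threaded THICK column on this line is HL3′ «PEAKLESS THICK TWISTING PROFILE» (model = the straight hot LINE / shear ridge `v₂ = N·sech²(y₁)`-type, `ψ = ψ(y₁)`,
straight vortex lines, whose exactly-symmetric version STRATUM-A-K2p4 THEOREM A-THICK kills; I8c shows boundedness is load-bearing).

LEVER (five words): **hot islands or dead planes** (v3: everywhere).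

SETTING.  S3 = `stub_threadedThickEmpty` (twist_split v5 / far_thread v4, VERBATIM): class e₃-poloidal profile, `N := v₂(−1,0) ≠ 0`,
`√(−t)|v₂(t,x)| ≤ |N|` everywhere (so `(−1,0)` is a space-time maximum of the scaled vertical speed), non-degenerate twisting windows accumulating at
`(−1,0)`, not (TH).  `P_{z₀} := {y : y 2 = z₀}`; on `P_0`, `f := σv₂(−1,·)`, `σ := sign N`, has its global maximum `|N|` exactly on the HOT SET
`Hot := {y ∈ P_0 : v₂(−1,y) = N} ∋ 0`.  ADMISSIBLE PAIR `(K,O)` (v1, VERBATIM): `K` compact, `0 ∈ K ⊆ Hot`, `O` open `⊇ K`, `Hot ∩ O ⊆ K`.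

THE CUT (kernel-checked): S3 ⇐ [`∃ (s₀,z₁,σ,M,K,O)` island data anywhere: HP3′ ⊢ island data on all nearby planes/times; HP1 ⊢ loop ∨ null patch on each;
S6G (via the PROVED `noLoopsOfGrowth_proof` · `periodScalingBound_proof`) kills the loop; HP4″ turns «null patches near (s₀, P_{z₁})» into `v ≡ 0`, contradicting
`N ≠ 0`] | [no island data anywhere: HL3′].  6 stubs: S0 (shared research, VERBATIM), HP1 `stub_islandOrNull` (provable, L; v2 VERBATIM), S6G
`stub_frequencyGrowthExponent` (THE WALL, BY NAME = item 27893), HP3′ `stub_islandsPersist` (provable, M; v3 VERBATIM), HP4″ `stub_nullRigidity` (provable, M/L;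
pin-free), HL3′ `stub_peaklessEmpty` (own typed residue; v3 VERBATIM).  Theorems: `zero_of_island` (pin-free corollary, hypothesis `FrequencyGrowthExponent` BY
NAME), compositions `threadedThickEmpty_of_hotLoops` (S3 VERBATIM), `LrcModEntire_of_hotLoops`, `PoloidalWindowRigidity_of_hotLoops` BY NAME.

BARRIER INVERTED (lens).  Local typing at the hot spot (finite jets: PINSHEET-g10 / THREAD-CENSUS-g10 / THREAD-PIN-ERRATUM; «hot-arc kill without
mechanism») is replaced by two GLOBAL planar objects that topology + the frozen law hand us for free — a compact regular `ψ`-level curve, or an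
irrotational planar patch — and each is killed by an EXISTING named instrument: the loop wall (item 27893, by name) resp. analyticity + Liouville +
mild identity + Type-I decay (provable, pin-free).  Nothing is read off a jet; no emptiness is claimed from a census; the polynomial sector (Theorem P), KNSS symmetry,
E-THICK, KGR, hodograph, state curves, z-energy flux, torus means, DSS columns are not used.

CHEAPEST FALSIFIER.  (1) HP1's one non-formal step is `dψ(J∇f) = ∓ω·∇v₂ = 0` on regular `v₂`-levels — the frozen law (tree `frozen_bracket` /
LoopPeriodRatchet first integral); a sign/convention slip is the only risk, and the composition elaborating against `noLoopsOfGrowth_proof` checks the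
loop shape (rc 0).  (2) Consistency: axisymmetric no-swirl hot spots (Hill type) give islands (vortex circles) — killed by the wall and independently
by KNSS; the I8c column family has irrotational planes (`P_z = 0`) but no isolated compact hot piece (planes entirely hot) and no boundedness — so both
alternatives of HP1 are populated kinematically and neither survives in class modulo S6G.  (3) HL3′ has no census handle (global): a PEAKLESS CLASS member (no strict compact
local extremum piece of `v₂` on any horizontal plane at any time) that is thick and twisting at an accumulation point would make HL3′ the summit of this column;
none known (A-THICK excludes the translation-invariant ridges).

WHAT THIS IS NOT: not a proof of Navier–Stokes regularity, of K2, of item 20428, or of S3: S3 is CUT into (island-world ⇐ S6G, kernel composition over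
three provable stubs) | HL3′, and S6G = `LoopPeriodRatchet.FrequencyGrowthExponent` is OPEN.  (M) and Type I are used essentially (HP4″: mild identity,
Type-I bound and decay, analyticity; honours `Negative.poloidalWindowRigidity_false_without_mild`, K-47); K-48/K-50: HL3′ is class-level; I8c: boundedness is
load-bearing in HP4″ and in HL3′.  bears_on LADDER-NS N0 (rung N0-LocalTubeDoorPoloidal), items 19708 / 20428.  No summit is proved by any line.
-/

noncomputable section

set_option linter.dupNamespace false
set_option linter.unusedVariables false

namespace Summit.NavierStokesRegularity.NavierStokesRegularity.Cruxes.PoloidalWindowRigidity.HotLoops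

open MeasureTheory Set Function Filter Topology Metric
open scoped RealInnerProductSpace InnerProductSpace Laplacian
open Literature.Analysis Literature.Analysis.FluidPDE
open Summit.NavierStokesRegularity.NavierStokesRegularity.Theses.PoloidalWindowDoor
open Summit.NavierStokesRegularity.NavierStokesRegularity.Theorems.PoloidalWindowDoorLrcModEntireTwistingTHLocalHypGerm
open Summit.NavierStokesRegularity.NavierStokesRegularity.Theorems.PoloidalWindowDoorLrcModEntireTwistingTHLocalNonUmbilic
open Summit.NavierStokesRegularity.NavierStokesRegularity.Theorems.PoloidalWindowDoorLrcModEntireTwistingTHLocalGalilean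
open Summit.NavierStokesRegularity.NavierStokesRegularity.Theorems.PoloidalWindowDoorLrcModEntireTwistingTHLocalNormalFormRS
open Summit.NavierStokesRegularity.NavierStokesRegularity.Theorems.PoloidalWindowDoorLrcModEntireFarThreadReduction

/-! ## Shared stubs (verbatim) -/

/-- **SHARED STUB ((TH) column) — VERBATIM `stub_localTHEmptyHypNUGRS` of the skeleton of record `Cruxes/LrcModEntire/Lines/twist_split.lean`
v4.3/v5 (ns-poloidal-K2-p3; item stmt-NavierStokesRegularity-20428; decider j301374).**  The local hyperbolic (TH)∩twisting PDE system is empty at a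
non-umbilic rest point in the rotation/scaling gauge.  One landing closes it here and there. -/
theorem stub_localTHEmptyHypNUGRS :
    ∀ (u : ℝ → EuclideanSpace ℝ (Fin 3) → EuclideanSpace ℝ (Fin 3)) (μ A : ℝ → ℝ → ℝ)
      (U : Set (ℝ × EuclideanSpace ℝ (Fin 3))) (p₀ : ℝ × EuclideanSpace ℝ (Fin 3)),
      IsOpen U → p₀ ∈ U →
      AnalyticOnNhd ℝ (Function.uncurry u) U →
      (∀ p ∈ U, AnalyticAt ℝ (Function.uncurry μ) (p.1, p.2 2)) →
      (∀ p ∈ U, AnalyticAt ℝ (Function.uncurry A) (p.1, p.2 2)) →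
      (∀ p ∈ U, fderiv ℝ (u p.1) p.2 (EuclideanSpace.single 0 1) 1 = fderiv ℝ (u p.1) p.2 (EuclideanSpace.single 1 1) 0) →
      (∀ p ∈ U, fderiv ℝ (u p.1) p.2 (EuclideanSpace.single 0 1) 0 + fderiv ℝ (u p.1) p.2 (EuclideanSpace.single 1 1) 1 +
        fderiv ℝ (u p.1) p.2 (EuclideanSpace.single 2 1) 2 = 0) →
      (∀ p ∈ U, ∀ b : Fin 3, b ≠ 2 →
        fderiv ℝ (u p.1) p.2 (EuclideanSpace.single 2 1) b =
          μ p.1 (p.2 2) * fderiv ℝ (u p.1) p.2 (EuclideanSpace.single b 1) 2) →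
      (∀ p ∈ U,
        (1 - μ p.1 (p.2 2)) *
            (deriv (fun s => u s p.2 2) p.1 + fderiv ℝ (fun y => u p.1 y 2) p.2 (u p.1 p.2)
              - Δ (fun y => u p.1 y 2) p.2) =
          A p.1 (p.2 2) + (deriv (fun s => μ s (p.2 2)) p.1 - deriv (deriv (μ p.1)) (p.2 2)) * u p.1 p.2 2
            + deriv (μ p.1) (p.2 2) / 2 * u p.1 p.2 2 ^ 2
            - 2 * deriv (μ p.1) (p.2 2) * fderiv ℝ (u p.1) p.2 (EuclideanSpace.single 2 1) 2) →
      fderiv ℝ (fun y => fderiv ℝ (u p₀.1) y (EuclideanSpace.single 2 1) 2) p₀.2 (EuclideanSpace.single 0 1) *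
            fderiv ℝ (u p₀.1) p₀.2 (EuclideanSpace.single 1 1) 2 -
          fderiv ℝ (fun y => fderiv ℝ (u p₀.1) y (EuclideanSpace.single 2 1) 2) p₀.2 (EuclideanSpace.single 1 1) *
            fderiv ℝ (u p₀.1) p₀.2 (EuclideanSpace.single 0 1) 2 ≠ 0 →
      μ p₀.1 (p₀.2 2) ≠ 0 → μ p₀.1 (p₀.2 2) ≠ 1 → deriv (μ p₀.1) (p₀.2 2) ≠ 0 →
      μ p₀.1 (p₀.2 2) < 0 →
      (fderiv ℝ (u p₀.1) p₀.2 (EuclideanSpace.single 0 1) 0 ≠ fderiv ℝ (u p₀.1) p₀.2 (EuclideanSpace.single 1 1) 1 ∨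
        fderiv ℝ (u p₀.1) p₀.2 (EuclideanSpace.single 1 1) 0 ≠ 0) →
      u p₀.1 p₀.2 = 0 → 
      fderiv ℝ (u p₀.1) p₀.2 (EuclideanSpace.single 0 1) 2 = 0 →
      fderiv ℝ (u p₀.1) p₀.2 (EuclideanSpace.single 1 1) 2 = 1 → False := by
  sorry

/-- **SHARED STUB S6G (THE NAMED WALL, BY NAME = route item stmt-NavierStokesRegularity-27893; thread_axis v8–v10.2, centre_type v4, hot_loops v1):
`LoopPeriodRatchet.FrequencyGrowthExponent`.**  With the PROVED `PeriodScalingBound` and `noLoopsOfGrowth_proof`: class poloidal profiles carry NO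
non-stationary closed vortex line at any time `s < 0`.  OPEN; research; met by name — nothing about it is claimed here.  Why it might fail: it is the
standing wall of the loop world (I8a/I9: dead off symmetry as a ratchet; I8c: boundedness load-bearing). -/
theorem stub_frequencyGrowthExponent :
    Summit.NavierStokesRegularity.NavierStokesRegularity.Theses.LoopPeriodRatchet.FrequencyGrowthExponent := by
  sorry

/-! ## Own stubs (v3): islands-or-null (v2 VERBATIM), islands persist, null rigidity, and the peakless residue -/

/-- **HP1 — DISCHARGED BY NAME (v4.2) from the landed `Theorems/…HotLoopsIslandOrNull.lean` (p664413, K2-p2 g11; VERBATIM statement; core `…IslandOrNullCore.loop_or_nullDisc`).  Was: STUB HP1 (PROVABLE, L): HOT ISLANDS OR DEAD PLANES.**  Class profile, e₃-poloidal at all times; a time `s < 0`, a height `z₀`, a sign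
`σ = ±1`, a value `M`, and an ISOLATED COMPACT PIECE `K ≠ ∅` of the planar `M`-level set of `σv₂(s,·)` on `P_{z₀} = {y 2 = z₀}` which is a local
MAXIMUM set: `O` open `⊇ K`, `σv₂(s,·) ≤ M` on `O ∩ P_{z₀}`, and every point of `O ∩ P_{z₀}` at level `M` lies in `K`.  CONCLUSION: a non-stationary
periodic orbit of `y′ = curl v(s)(y)` (VERBATIM the loop shape of `LoopPeriodRatchet.NoLoopsOfGrowth`), OR an open planar disc of `P_{z₀}` on which
`curl v(s) = 0`.
PROOF.  `f := σv₂(s,·)|_{P_{z₀}}`, smooth (tree `…Clebsch.contDiff_slice`).  (a) COLLAR: `∃ ρ > 0`, `R := {y ∈ P_{z₀} : infDist(y,K) ≤ ρ} ⊆ O`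
compact, `f ≤ M` on `R`, `f < M` on `R ∖ K ⊇ S_ρ := {infDist = ρ}` (level-`M` points of `O ∩ P_{z₀}` are in `K`), so `m := max_{S_ρ} f < M`
(`S_ρ = ∅` only eases things).  (b) Pick `c ∈ (m, M)` a REGULAR value of `f` on `R` (planar `C²` Sard: tree `…NoPlanarExtremumSard.exists_regular_level`
pattern) and `k₀ ∈ K`; `C := ` the connected component of `{y ∈ R : f y ≥ c}` containing `k₀`: compact, connected, `C ∩ S_ρ = ∅`, hence
`int_{P}C ⊇ {f > c} ∩ C ∋ k₀` and `∂_P C = C ∩ {f = c}` is a compact open-closed part of the regular level `{f = c}`: finitely many embedded circles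
`Γ₁,…,Γ_m` with tangent `J∇f`.  (c) STREAM FUNCTION: tree `exists_clebsch_slice` at time `s` gives smooth `ψ` with `curl v(s) = (∂₁ψ, −∂₀ψ, 0)`; put
`G := ψ|_{P_{z₀}}`, so `curl v(s)|_{P_{z₀}} = J∇G` is tangent to `G`-levels and vanishes exactly at `Crit G`.  FROZEN LAW (tree `frozen_bracket` /
LoopPeriodRatchet first integral): `curl v(s)·∇v₂(s,·) = 0`, i.e. `⟨J∇G, ∇f⟩ = 0`, i.e. `dG(J∇f) = 0`: `G` is CONSTANT on each circle `Γ_i`, value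
`b_i`.  (d) DICHOTOMY on the continuum `C`: let `mn ≤ Mx` be the extrema of `G` on `C`.  If `mn < Mx`, choose `λ ∈ (mn, Mx) ∖ {b₁,…,b_m}` that is a
regular value of `G` on `C` (Sard again; a co-null set minus finitely many points is non-empty); `G` takes the value `λ` on `C` (connected image) at a
point `p ∉ ∂_P C`; the component `Λ` of `{G = λ} ∩ P_{z₀}` through `p` cannot meet `∂_P C` (values `b_i ≠ λ`), so `Λ ⊆ int_P C` is a compact connected
REGULAR level curve of `G` — a circle on which `J∇G = curl v(s) ≠ 0` is tangent: a non-stationary periodic orbit (tree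
`…NoPlanarExtremumLevelOrbit.exists_periodic_orbit_of_regular_planar_level` after the cut-off localisation of `…Core.exists_periodic_orbit_of_strict_planar_min`
step (e); or directly `LevelCurveData.injective_or_periodic`).  If `mn = Mx`, `G` is constant on `C`, so `∇G = 0` on `int_P C ∋ k₀`: `curl v(s) = 0` on a
planar disc around `k₀`.  Why it might fail: it cannot as stated (classical: Liouville–Arnold with one degree of freedom [corpus:book:arnold1989 p.230]
+ a maximum-principle dichotomy); Lean size L (two Sard calls, component bookkeeping, the Khovanskii orbit; every piece has a tree template). -/
theorem stub_islandOrNull :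
    ∀ (C : ℝ) (v : ℝ → EuclideanSpace ℝ (Fin 3) → EuclideanSpace ℝ (Fin 3)),
      Literature.Analysis.FluidPDE.HasTypeITimeDecay C v →
      ContinuousOn (Function.uncurry v) (Set.Iio (0 : ℝ) ×ˢ Set.univ) →
      (∀ s t : ℝ, s < t → t < 0 → ∀ x, v t x =
        Literature.Analysis.UnboundedOperators.heatExtension (v s) (t - s) x -
          Literature.Analysis.FluidPDE.oseenDuhamel 1 s v v t x) →
      (∀ t < 0, Literature.Analysis.FluidPDE.VectorCalculus.IsDivFree (v t)) →
      (∀ s < 0, ∀ y, ⟪Literature.Analysis.FluidPDE.curl (v s) y, EuclideanSpace.single 2 1⟫_ℝ = 0) →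
      ∀ (s z₀ σ M : ℝ) (K O : Set (EuclideanSpace ℝ (Fin 3))), s < 0 →
        ((σ = 1 ∨ σ = -1) ∧ IsCompact K ∧ K.Nonempty ∧ (∀ y ∈ K, y 2 = z₀ ∧ σ * v s y 2 = M) ∧
          IsOpen O ∧ K ⊆ O ∧ (∀ y ∈ O, y 2 = z₀ → σ * v s y 2 ≤ M) ∧
          (∀ y ∈ O, y 2 = z₀ → σ * v s y 2 = M → y ∈ K)) →
        (∃ (γ : ℝ → EuclideanSpace ℝ (Fin 3)) (ℓ : ℝ), 0 < ℓ ∧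
          (∀ θ, HasDerivAt γ (Literature.Analysis.FluidPDE.curl (v s) (γ θ)) θ) ∧
          (∀ θ, γ (θ + ℓ) = γ θ) ∧ Literature.Analysis.FluidPDE.curl (v s) (γ 0) ≠ 0) ∨
        (∃ (y₀ : EuclideanSpace ℝ (Fin 3)) (r : ℝ), y₀ 2 = z₀ ∧ 0 < r ∧
          ∀ y : EuclideanSpace ℝ (Fin 3), y 2 = z₀ → dist y y₀ < r → Literature.Analysis.FluidPDE.curl (v s) y = 0) :=
  Summit.NavierStokesRegularity.NavierStokesRegularity.Theorems.PoloidalWindowDoorPoloidalWindowRigidityHotLoopsIslandOrNull.stub_islandOrNull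

/-- **HP3′ — DISCHARGED BY NAME (v4.2) from the landed `Theorems/…HotLoopsIslandsPersist.lean` (p664434, K2-p2 g11; VERBATIM statement).  Was: STUB HP3′ (PROVABLE, M): ISLANDS PERSIST ON NEARBY PLANES AND TIMES (v3: anywhere, any time, no pin).**  Class continuity on `{s < 0}`; island data at
`(s₀, P_{z₁})`: `σ = ±1`, `K` compact non-empty `⊂ P_{z₁}` at level `M` of `σv₂(s₀,·)`, `O` open `⊇ K`, `σv₂(s₀,·) ≤ M` on `O ∩ P_{z₁}`, level-`M` points of
`O ∩ P_{z₁}` in `K` (exactly HP1's bracket).  CONCLUSION: `∃ δ > 0` such that for all `|s − s₀| < δ`, `|z₀ − z₁| < δ`: `s < 0` and HP1's bracket holds at `(s, P_{z₀})`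
for the same `σ` and some `M'`, `K'`, `O'`.
PROOF.  `f := σv₂(s₀,·)|_{P_{z₁}}`.  Collar: `ρ > 0` with `R := {y ∈ P_{z₁} : infDist(y,K) ≤ ρ} ⊆ O` (compact); `f < M` on `∂_P R ⊆ {infDist = ρ}` (level-`M` points of
`O ∩ P_{z₁}` lie in `K`, `K ∩ ∂_P R = ∅`), so `m := max_{∂_P R} f < M` (`∂_P R ≠ ∅` as `P_{z₁}` is connected and `R ≠ P_{z₁}`).  Joint continuity of `(s,y) ↦ v s y` on
`{s < 0} × ℝ³` (hcont) and compactness of `[s₀ − |s₀|/2, s₀ + |s₀|/2] × (R + [−1,1]e₂)` give `δ ∈ (0, min(|s₀|/2, 1))` with `|σv₂(s, y + (z₀−z₁)e₂) − σv₂(s₀,y)| <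
(M − m)/3` for `y ∈ R`, `|s − s₀| < δ`, `|z₀ − z₁| < δ`.  Put `g(y) := σv₂(s, y + (z₀−z₁)e₂)` on `R`, `M' := max_R g` (attained, `R ≠ ∅`), `K' := {y + (z₀−z₁)e₂ :
y ∈ R, g y = M'}` (compact, non-empty, inside `P_{z₀}`, at level `M'`), `O' := {x : x − (x 2 − z₁)e₂ ∈ relint_P R}` (open; `O' ∩ P_{z₀} = relint_P R + (z₀−z₁)e₂`).
Then `g ≤ M'` on `O' ∩ P_{z₀}`, level-`M'` points there are in `K'` by definition, and `K' ⊆ O'` because on `∂_P R`, `g < m + (M−m)/3 < M − (M−m)/3 < g(k)` for any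
`k ∈ K`, so no maximiser lies on `∂_P R`.  `s < 0` from `δ ≤ |s₀|/2`.  Why it might fail: it cannot; size M (`Metric.infDist`, `IsCompact.exists_isMaxOn`, uniform
continuity on compacts).  No pin, no maximality of `M` beyond `O`, no analyticity used. -/
theorem stub_islandsPersist :
    ∀ (C : ℝ) (v : ℝ → EuclideanSpace ℝ (Fin 3) → EuclideanSpace ℝ (Fin 3)),
      Literature.Analysis.FluidPDE.HasTypeITimeDecay C v →
      ContinuousOn (Function.uncurry v) (Set.Iio (0 : ℝ) ×ˢ Set.univ) →
      (∀ s t : ℝ, s < t → t < 0 → ∀ x, v t x =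
        Literature.Analysis.UnboundedOperators.heatExtension (v s) (t - s) x -
          Literature.Analysis.FluidPDE.oseenDuhamel 1 s v v t x) →
      (∀ t < 0, Literature.Analysis.FluidPDE.VectorCalculus.IsDivFree (v t)) →
      (∀ s < 0, ∀ y, ⟪Literature.Analysis.FluidPDE.curl (v s) y, EuclideanSpace.single 2 1⟫_ℝ = 0) →
      ∀ (s₀ z₁ σ M : ℝ) (K O : Set (EuclideanSpace ℝ (Fin 3))), s₀ < 0 →
        ((σ = 1 ∨ σ = -1) ∧ IsCompact K ∧ K.Nonempty ∧ (∀ y ∈ K, y 2 = z₁ ∧ σ * v s₀ y 2 = M) ∧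
          IsOpen O ∧ K ⊆ O ∧ (∀ y ∈ O, y 2 = z₁ → σ * v s₀ y 2 ≤ M) ∧
          (∀ y ∈ O, y 2 = z₁ → σ * v s₀ y 2 = M → y ∈ K)) →
        ∃ δ : ℝ, 0 < δ ∧ ∀ s z₀ : ℝ, |s - s₀| < δ → |z₀ - z₁| < δ →
          s < 0 ∧ ∃ (M' : ℝ) (K' O' : Set (EuclideanSpace ℝ (Fin 3))),
            ((σ = 1 ∨ σ = -1) ∧ IsCompact K' ∧ K'.Nonempty ∧ (∀ y ∈ K', y 2 = z₀ ∧ σ * v s y 2 = M') ∧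
              IsOpen O' ∧ K' ⊆ O' ∧ (∀ y ∈ O', y 2 = z₀ → σ * v s y 2 ≤ M') ∧
              (∀ y ∈ O', y 2 = z₀ → σ * v s y 2 = M' → y ∈ K')) :=
  Summit.NavierStokesRegularity.NavierStokesRegularity.Theorems.PoloidalWindowDoorPoloidalWindowRigidityHotLoopsIslandsPersist.stub_islandsPersist

/-- **HP4″ — DISCHARGED BY NAME (v4.3) from the landed `Theorems/…HotLoopsNullRigidityPinFree.lean` (p665858, K2-p2 g11; VERBATIM statement).  Was: STUB HP4″ (PROVABLE, M/L; v4: PIN-FREE): IRROTATIONAL PATCHES ON ALL PLANES NEAR `P_{z₁}` AT ALL TIMES NEAR `s₀` FORCE `v ≡ 0` (NULL RIGIDITY).**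
Class profile (Type I, continuous, Oseen-mild from every past time, divergence-free, e₃-poloidal); suppose `∃ s₀ < 0, z₁, δ > 0` such that for all `|s − s₀| < δ`,
`|z₀ − z₁| < δ` the plane `P_{z₀}` contains an open disc on which `curl v(s) = 0`.  Then `v(t,x) = 0` for all `t < 0`, `x`.
PROOF.  WLOG `δ ≤ |s₀|/2`, so `I := (s₀ − δ, s₀ + δ) ⊂ (−∞,0)`.  (1) ANALYTICITY (tree, PROVED): `…Theorems.LocalSineTubeDoorProfileAlignedWindowRigidityAncient.analyticOnNhd_uncurry
hcont (bdd_of_hasTypeITimeDecay hrate)` — `uncurry v` is jointly real-analytic on `{s < 0} × ℝ³`; hence for fixed `s ∈ I` each component of `curl v(s)` restricted to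
`P_{z₀}` is real-analytic on the connected `ℝ²`, and vanishing on a disc forces vanishing on `P_{z₀}` (`AnalyticOnNhd.eqOn_zero_of_preconnected_of_eventuallyEq_zero`);
so `curl v(s) = 0` on the open slab `{|y 2 − z₁| < δ}`, hence on `ℝ³` (same lemma in `ℝ³`), for every `s ∈ I`.  (2) LIOUVILLE: `curl v(s) = 0`, `div v(s) = 0`, `v(s,·)`
smooth ⇒ `Δv(s,·) = ∇div − curl curl = 0` componentwise; bounded (`‖v(s,x)‖ ≤ C/√(−s)`) harmonic on `ℝ³` ⇒ constant `=: c(s)` — tree, PROVED: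
`Literature.Analysis.FluidPDE.isConst_of_harmonic_bounded_inner` ∘ `harmonicOnNhd_of_laplacian_eq_zero` (Gilbarg–Trudinger Thm 2.10; used this way in
`tsai_selfsimilar_bounded_holds`).  (3) TIME: for `s < t` in `I` the mild identity reads `c(t) = heatExtension (const c(s)) (t−s) − oseenDuhamel 1 s v v t`; the heat
extension of a constant is the constant (tree `Literature.Analysis.UnboundedOperators.heatExtension_const`) and the Oseen–Duhamel term of a spatially constant tensor
vanishes (`oseenDuhamel` = time integral of `oseenSlice (t−τ) (v τ) (v τ)`, `oseenSlice σ a b x = ∫ oseenKernel σ (x−y) (a y) (b y) dy`, and the kernel has VANISHING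
MEAN: tree `integral_oseenKernel_eq_zero`), so `c` is constant on `I`.  (4) TIME-ANALYTICITY: for each `x`, `s ↦ v(s,x) − c` is real-analytic on the connected
`(−∞,0)` and vanishes on `I`, hence everywhere: `v ≡ c` on `(−∞,0) × ℝ³`.  (5) DECAY: `‖c‖ = ‖v(t,0)‖ ≤ C/√(−t)` for every `t < 0` (`HasTypeITimeDecay`), and
`C/√(−t) → 0` as `t → −∞`; so `c = 0`.  No pin, no normalisation is used (v3's HP4′ = this + `N ≠ 0`, one line in the composition).  Why it might fail: it cannot;
size M/L — every ingredient is a PROVED tree lemma by name (joint analyticity, identity theorem, harmonic Liouville, heat extension of constants, vanishing mean of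
the Oseen kernel, Type-I decay).  Boundedness and (M) are used essentially — honours I8c and K-47. -/
theorem stub_nullRigidity :
    ∀ (C : ℝ) (v : ℝ → EuclideanSpace ℝ (Fin 3) → EuclideanSpace ℝ (Fin 3)),
      Literature.Analysis.FluidPDE.HasTypeITimeDecay C v →
      ContinuousOn (Function.uncurry v) (Set.Iio (0 : ℝ) ×ˢ Set.univ) →
      (∀ s t : ℝ, s < t → t < 0 → ∀ x, v t x =
        Literature.Analysis.UnboundedOperators.heatExtension (v s) (t - s) x -
          Literature.Analysis.FluidPDE.oseenDuhamel 1 s v v t x) →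
      (∀ t < 0, Literature.Analysis.FluidPDE.VectorCalculus.IsDivFree (v t)) →
      (∀ s < 0, ∀ y, ⟪Literature.Analysis.FluidPDE.curl (v s) y, EuclideanSpace.single 2 1⟫_ℝ = 0) →
      (∃ s₀ z₁ δ : ℝ, s₀ < 0 ∧ 0 < δ ∧ ∀ s z₀ : ℝ, |s - s₀| < δ → |z₀ - z₁| < δ →
          (∃ (y₀ : EuclideanSpace ℝ (Fin 3)) (r : ℝ), y₀ 2 = z₀ ∧ 0 < r ∧
          ∀ y : EuclideanSpace ℝ (Fin 3), y 2 = z₀ → dist y y₀ < r → Literature.Analysis.FluidPDE.curl (v s) y = 0)) →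
      ∀ t < 0, ∀ x, v t x = 0 :=
  Summit.NavierStokesRegularity.NavierStokesRegularity.Theorems.PoloidalWindowDoorPoloidalWindowRigidityHotLoopsNullRigidityPinFree.stub_nullRigidity

/-- **HP4′ (v3 statement, PINNED) — LANDED, cited BY NAME (v4.2): `Theorems/…HotLoopsNullRigidity.stub_nullRigidity` (p664456, K2-p2 g11).**  Class profile WITH the pin
`N = v₂(−1,0) ≠ 0`, `√(−t)|v₂| ≤ |N|`; irrotational planar patches on all planes near `P_{z₁}` at all times near some `s₀ < 0` ⇒ `False` (their proof: planes ⇒ slab ⇒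
`curl ≡ 0` ⇒ constant slices ⇒ constant in time on the window ⇒ TIME-ANALYTICITY ⇒ `v ≡ c` on `(−∞,0) × ℝ³` ⇒ the pin at `t = −2` is absurd).  Used in the S3
composition instead of the pin-free stub HP4″ (which needs only the extra decay step `‖c‖ ≤ C/√(−t) → 0`; HP4″ stays a stub for `zero_of_island` and the offer). -/
theorem nullRigidityPinned :
    ∀ (C : ℝ) (v : ℝ → EuclideanSpace ℝ (Fin 3) → EuclideanSpace ℝ (Fin 3)),
      Literature.Analysis.FluidPDE.HasTypeITimeDecay C v →
      ContinuousOn (Function.uncurry v) (Set.Iio (0 : ℝ) ×ˢ Set.univ) →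
      (∀ s t : ℝ, s < t → t < 0 → ∀ x, v t x =
        Literature.Analysis.UnboundedOperators.heatExtension (v s) (t - s) x -
          Literature.Analysis.FluidPDE.oseenDuhamel 1 s v v t x) →
      (∀ t < 0, Literature.Analysis.FluidPDE.VectorCalculus.IsDivFree (v t)) →
      (∀ s < 0, ∀ y, ⟪Literature.Analysis.FluidPDE.curl (v s) y, EuclideanSpace.single 2 1⟫_ℝ = 0) →
      v (-1) 0 2 ≠ 0 → (∀ t < 0, ∀ x, Real.sqrt (-t) * |v t x 2| ≤ |v (-1) 0 2|) →
      (∃ s₀ z₁ δ : ℝ, s₀ < 0 ∧ 0 < δ ∧ ∀ s z₀ : ℝ, |s - s₀| < δ → |z₀ - z₁| < δ →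
          (∃ (y₀ : EuclideanSpace ℝ (Fin 3)) (r : ℝ), y₀ 2 = z₀ ∧ 0 < r ∧
          ∀ y : EuclideanSpace ℝ (Fin 3), y 2 = z₀ → dist y y₀ < r → Literature.Analysis.FluidPDE.curl (v s) y = 0)) →
      False :=
  Summit.NavierStokesRegularity.NavierStokesRegularity.Theorems.PoloidalWindowDoorPoloidalWindowRigidityHotLoopsNullRigidity.stub_nullRigidity

/-- **STUB HL3′ (OWN, TYPED RESIDUE «PEAKLESS THICK TWISTING PROFILE»; v3 — the ONLY residue of the threaded THICK column on this line).**
`stub_threadedThickEmpty` VERBATIM, plus PEAKLESSNESS: at NO time `s < 0`, on NO horizontal plane `P_{z₀}`, for NO sign `σ = ±1` and NO level `M` is there an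
isolated compact strict-local-maximum piece of `σv₂(s,·)|_{P_{z₀}}` (HP1's bracket never holds).  Typed content: on every plane at every time the bounded
real-analytic function `v₂(s,·)|_{P_{z₀}}` has only NON-COMPACT strict local extremal sets — ridges and valleys running to infinity — or none (no strict local
extremum POINT anywhere, ever; every compact component of every level set of `v₂|_P` bounds no strict peak, so by the maximum principle for the level topology
every level-set component on every plane is unbounded or encloses a plateau — and plateaus are whole planes by analyticity); at `(−1, P_0)`: every component of
`Hot = {v₂(−1,·) = N} ∩ P_0` is unbounded (an analytic hot curve to infinity through `0`, all thread pins along it, `Δv₂ − ∂_z p = N/2` on it; `ψ` constant on it, so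
it is a planar VORTEX LINE of hot points where `ω ≠ 0`), or `Hot = P_0` (then `v(−1,·)|_{P_0}` is CONSTANT: `∂_z v₂ = 0` on `P_0` by maximality, `div v = 0` and
poloidality make `(v₀,v₁)|_{P_0} = ∇ₕφ` with `φ` harmonic on `ℝ²` and `∇φ` bounded ⇒ constant; and `σ∂_z p ≤ −|N|/2` on all of `P_0` from the time-max pin).  On such
configurations the lever is silent by nature (`ψ` is constant on the unbounded `v₂`-level curves; model: shear ridge `v₂ = N − y₁²·(…)`, `ψ = ψ(y₁)`, straight vortex
lines).  REALISED WITHOUT BOUNDEDNESS by the I8c column family (planes entirely hot) ⇒ boundedness is load-bearing (honours I8c).  Named neighbour theorem: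
STRATUM-A-K2p4 THEOREM A-THICK (vorticity invariant under a horizontal translation ⇒ no thick non-degenerate twisting point).  Candidate transfers, NOT claimed:
(i) recentre along the hot component (`v(·, · + y_n)`, `y_n ∈ Hot → ∞`) + class compactness ⇒ class profiles with a bi-infinite hot vortex line through `0`; missing
input: asymptotic straightness / a tangent flow at infinity in stratum (A), after which A-THICK would bite; (ii) the hot-plane sub-cell: `v(−1,·)|_{P_0}` constant
+ uniform `∂_z p` sign on a plane vs. the Riesz-transform pressure of a bounded field.  No census handle (global object).  Why it might fail: a peakless profile is
invisible to every local or finite-jet argument; only Liouville-type class arguments can empty it, and their wall is KNSS-type rigidity, which needs symmetry. -/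
theorem stub_peaklessEmpty :
    ∀ (C : ℝ) (v : ℝ → EuclideanSpace ℝ (Fin 3) → EuclideanSpace ℝ (Fin 3)),
      Literature.Analysis.FluidPDE.HasTypeITimeDecay C v →
      ContinuousOn (Function.uncurry v) (Set.Iio (0 : ℝ) ×ˢ Set.univ) →
      (∀ s t : ℝ, s < t → t < 0 → ∀ x, v t x =
        Literature.Analysis.UnboundedOperators.heatExtension (v s) (t - s) x -
          Literature.Analysis.FluidPDE.oseenDuhamel 1 s v v t x) →
      (∀ t < 0, Literature.Analysis.FluidPDE.VectorCalculus.IsDivFree (v t)) →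
      (∀ s < 0, ∀ y, ⟪Literature.Analysis.FluidPDE.curl (v s) y, EuclideanSpace.single 2 1⟫_ℝ = 0) →
      v (-1) 0 2 ≠ 0 → (∀ t < 0, ∀ x, Real.sqrt (-t) * |v t x 2| ≤ |v (-1) 0 2|) →
      (∀ h : EuclideanSpace ℝ (Fin 3), fderiv ℝ (v (-1)) 0 h 2 = 0) →
      (deriv (fun s => v s 0 2) (-1) = v (-1) 0 2 / 2 ∧ v (-1) 0 2 * (Δ (fun y => v (-1) y 2)) 0 ≤ 0) →
      ∀ W : Set (ℝ × EuclideanSpace ℝ (Fin 3)), IsOpen W → W ⊆ Set.Iio (0 : ℝ) ×ˢ Set.univ →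
        (∀ z ∈ W, (Literature.Analysis.FluidPDE.curl (v z.1) z.2 ≠ 0 ∧
            (fderiv ℝ (v z.1) z.2 (EuclideanSpace.single 0 1) 2 ≠ 0 ∨ fderiv ℝ (v z.1) z.2 (EuclideanSpace.single 1 1) 2 ≠ 0) ∧
            (fderiv ℝ (v z.1) z.2 (EuclideanSpace.single 2 1) 0 ≠ 0 ∨ fderiv ℝ (v z.1) z.2 (EuclideanSpace.single 2 1) 1 ≠ 0)) ∧
          (fderiv ℝ (fun x => fderiv ℝ (v z.1) x (EuclideanSpace.single 2 1) 2) z.2 (EuclideanSpace.single 0 1) *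
                fderiv ℝ (v z.1) z.2 (EuclideanSpace.single 1 1) 2 -
              fderiv ℝ (fun x => fderiv ℝ (v z.1) x (EuclideanSpace.single 2 1) 2) z.2 (EuclideanSpace.single 1 1) *
                fderiv ℝ (v z.1) z.2 (EuclideanSpace.single 0 1) 2 ≠ 0)) →
        (∀ m : ℝ → ℝ → ℝ, ∀ W₁ : Set (ℝ × EuclideanSpace ℝ (Fin 3)), W₁ ⊆ W → IsOpen W₁ → W₁.Nonempty →
            ∃ z ∈ W₁, ∃ b : Fin 3, b ≠ 2 ∧
              fderiv ℝ (v z.1) z.2 (EuclideanSpace.single 2 1) b ≠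
                m z.1 (z.2 2) * fderiv ℝ (v z.1) z.2 (EuclideanSpace.single b 1) 2) →
        (∀ r : ℝ, 0 < r → (Metric.ball ((-1 : ℝ), (0 : EuclideanSpace ℝ (Fin 3))) r ∩ W).Nonempty) →
        
        (∀ (s z₀ σ M : ℝ) (K O : Set (EuclideanSpace ℝ (Fin 3))), s < 0 →
          ((σ = 1 ∨ σ = -1) ∧ IsCompact K ∧ K.Nonempty ∧ (∀ y ∈ K, y 2 = z₀ ∧ σ * v s y 2 = M) ∧
            IsOpen O ∧ K ⊆ O ∧ (∀ y ∈ O, y 2 = z₀ → σ * v s y 2 ≤ M) ∧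
            (∀ y ∈ O, y 2 = z₀ → σ * v s y 2 = M → y ∈ K)) → False) →
        False := by
  sorry

/-! ## Compositions -/

/-- **KERNEL-CHECKED (v4.2; no own stub inside): modulo the wall, an island bracket anywhere yields a WINDOW OF DEAD PLANES** — irrotational planar patches on
every plane near `P_{z₁}` at every time near `s₀`: landed HP3′ (brackets persist) → landed HP1 (loop ∨ null patch) → the loop branch is killed by the PROVED
`noLoopsOfGrowth_proof` · `periodScalingBound_proof` under the wall hypothesis `FrequencyGrowthExponent` (item 27893, BY NAME). -/
theorem nullWindow_of_island
    (hG : Summit.NavierStokesRegularity.NavierStokesRegularity.Theses.LoopPeriodRatchet.FrequencyGrowthExponent) :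
    ∀ (C : ℝ) (v : ℝ → EuclideanSpace ℝ (Fin 3) → EuclideanSpace ℝ (Fin 3)),
      Literature.Analysis.FluidPDE.HasTypeITimeDecay C v →
      ContinuousOn (Function.uncurry v) (Set.Iio (0 : ℝ) ×ˢ Set.univ) →
      (∀ s t : ℝ, s < t → t < 0 → ∀ x, v t x =
        Literature.Analysis.UnboundedOperators.heatExtension (v s) (t - s) x -
          Literature.Analysis.FluidPDE.oseenDuhamel 1 s v v t x) →
      (∀ t < 0, Literature.Analysis.FluidPDE.VectorCalculus.IsDivFree (v t)) →
      (∀ s < 0, ∀ y, ⟪Literature.Analysis.FluidPDE.curl (v s) y, EuclideanSpace.single 2 1⟫_ℝ = 0) →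
      ∀ (s₀ z₁ σ M : ℝ) (K O : Set (EuclideanSpace ℝ (Fin 3))), s₀ < 0 →
        ((σ = 1 ∨ σ = -1) ∧ IsCompact K ∧ K.Nonempty ∧ (∀ y ∈ K, y 2 = z₁ ∧ σ * v s₀ y 2 = M) ∧
          IsOpen O ∧ K ⊆ O ∧ (∀ y ∈ O, y 2 = z₁ → σ * v s₀ y 2 ≤ M) ∧
          (∀ y ∈ O, y 2 = z₁ → σ * v s₀ y 2 = M → y ∈ K)) →
        ∃ s₁ z₂ δ : ℝ, s₁ < 0 ∧ 0 < δ ∧ ∀ s z₀ : ℝ, |s - s₁| < δ → |z₀ - z₂| < δ →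
          (∃ (y₀ : EuclideanSpace ℝ (Fin 3)) (r : ℝ), y₀ 2 = z₀ ∧ 0 < r ∧
          ∀ y : EuclideanSpace ℝ (Fin 3), y 2 = z₀ → dist y y₀ < r → Literature.Analysis.FluidPDE.curl (v s) y = 0) := by
  intro C v hrate hcont hmild hdiv hpol s₀ z₁ σ M K O hs₀ hisl
  obtain ⟨δ, hδ, hnear⟩ := stub_islandsPersist C v hrate hcont hmild hdiv hpol s₀ z₁ σ M K O hs₀ hisl
  refine ⟨s₀, z₁, δ, hs₀, hδ, fun s z₀ hs hz => ?_⟩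
  obtain ⟨hs0, M', K', O', hisl'⟩ := hnear s z₀ hs hz
  rcases stub_islandOrNull C v hrate hcont hmild hdiv hpol s z₀ σ M' K' O' hs0 hisl' with ⟨γ, ℓ, hℓ, hγ, hper, hne⟩ | hnull
  · exact (hne
      (Summit.NavierStokesRegularity.NavierStokesRegularity.Theorems.LoopPeriodRatchetNoLoopsOfGrowth.noLoopsOfGrowth_proof
        hG
        Summit.NavierStokesRegularity.NavierStokesRegularity.Theorems.LoopPeriodRatchetPeriodScalingBound.periodScalingBound_proof
        C v hrate hcont hmild hdiv hpol s hs0 γ ℓ hℓ hγ hper)).elim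
  · exact hnull

/-- **PIN-FREE COROLLARY (exported; v4): modulo the wall, an island bracket anywhere forces `v ≡ 0`** — `nullWindow_of_island` (landed HP3′, landed HP1, the wall
by name) followed by the pin-free null rigidity HP4″ (stub).  «Modulo 27893 (and HP4″) every NON-ZERO class e₃-poloidal profile is PEAKLESS.» -/
theorem zero_of_island
    (hG : Summit.NavierStokesRegularity.NavierStokesRegularity.Theses.LoopPeriodRatchet.FrequencyGrowthExponent) :
    ∀ (C : ℝ) (v : ℝ → EuclideanSpace ℝ (Fin 3) → EuclideanSpace ℝ (Fin 3)),
      Literature.Analysis.FluidPDE.HasTypeITimeDecay C v →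
      ContinuousOn (Function.uncurry v) (Set.Iio (0 : ℝ) ×ˢ Set.univ) →
      (∀ s t : ℝ, s < t → t < 0 → ∀ x, v t x =
        Literature.Analysis.UnboundedOperators.heatExtension (v s) (t - s) x -
          Literature.Analysis.FluidPDE.oseenDuhamel 1 s v v t x) →
      (∀ t < 0, Literature.Analysis.FluidPDE.VectorCalculus.IsDivFree (v t)) →
      (∀ s < 0, ∀ y, ⟪Literature.Analysis.FluidPDE.curl (v s) y, EuclideanSpace.single 2 1⟫_ℝ = 0) →
      ∀ (s₀ z₁ σ M : ℝ) (K O : Set (EuclideanSpace ℝ (Fin 3))), s₀ < 0 →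
        ((σ = 1 ∨ σ = -1) ∧ IsCompact K ∧ K.Nonempty ∧ (∀ y ∈ K, y 2 = z₁ ∧ σ * v s₀ y 2 = M) ∧
          IsOpen O ∧ K ⊆ O ∧ (∀ y ∈ O, y 2 = z₁ → σ * v s₀ y 2 ≤ M) ∧
          (∀ y ∈ O, y 2 = z₁ → σ * v s₀ y 2 = M → y ∈ K)) →
        ∀ t < 0, ∀ x, v t x = 0 := by
  intro C v hrate hcont hmild hdiv hpol s₀ z₁ σ M K O hs₀ hisl
  exact stub_nullRigidity C v hrate hcont hmild hdiv hpol (nullWindow_of_island hG C v hrate hcont hmild hdiv hpol s₀ z₁ σ M K O hs₀ hisl)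

/-! ## Offer to `LoopPeriodRatchet` (custody of items 27893 / 22881) -/

/-- **REDUCTION OFFERED BY NAME (kernel-checked, v4.1): modulo the wall, LoopPeriodRatchet's residual Liouville crux 22881 may assume v₂-PEAKLESSNESS.**
The hypothesis `hPL` («PEAKLESS LIOUVILLE») is `LoopPeriodRatchet.PlanarExtremumLiouville` (item stmt-NavierStokesRegularity-22881) with its binders VERBATIM
(class, e₃-poloidal, frozen bracket, non-flat `∃ s < 0, ∃ y, ∂₀v₂ ≠ 0`, «ψ = v₂ − ∂₂Φ has no strict local extremum point in any horizontal plane at any time»)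
plus ONE more hypothesis: `v₂` has NO island bracket (no isolated compact strict-local-maximum piece of `σv₂(s,·)|_{P_{z₀}}`, either sign, any level) on any
horizontal plane at any time.  `FrequencyGrowthExponent → hPL → PlanarExtremumLiouville`: a profile with an island bracket is `≡ 0` by `zero_of_island`,
contradicting 22881's non-flatness binder; a peakless one is `hPL`'s.  Content for the 22881 attacker: sup / inf of `v₂` over every horizontal plane are END
VALUES along unbounded level lines too (not only those of `ψ`), every level-set component of `v₂|_P` is unbounded or the whole plane, and every regular
`v₂`-level line is a union of open vortex lines and null points.  Not a stub of this line and not load-bearing for 19708 / 20428; no sorry outside `stub_*`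
(uses HP3′, HP1, HP4″ through `zero_of_island`).  No item is closed by this: 22881 and 27893 are OPEN; it shows 22881 ⇐ (27893 ∧ hPL ∧ three provable stubs). -/
theorem planarExtremumLiouville_of_peakless
    (hG : Summit.NavierStokesRegularity.NavierStokesRegularity.Theses.LoopPeriodRatchet.FrequencyGrowthExponent)
    (hPL :
  ∀ (C : ℝ) (v : ℝ → EuclideanSpace ℝ (Fin 3) → EuclideanSpace ℝ (Fin 3)), Literature.Analysis.FluidPDE.HasTypeITimeDecay C v → ContinuousOn (Function.uncurry v) (Set.Iio (0 : ℝ) ×ˢ Set.univ) → (∀ s t : ℝ, s < t → t < 0 → ∀ x, v t x = Literature.Analysis.UnboundedOperators.heatExtension (v s) (t - s) x - Literature.Analysis.FluidPDE.oseenDuhamel 1 s v v t x) → (∀ t < 0, Literature.Analysis.FluidPDE.VectorCalculus.IsDivFree (v t)) → (∀ s < 0, ∀ y, ⟪Literature.Analysis.FluidPDE.curl (v s) y, EuclideanSpace.single 2 1⟫_ℝ = 0) → (∀ s < 0, ∀ y, ⟪fderiv ℝ (v s) y (Literature.Analysis.FluidPDE.curl (v s) y), EuclideanSpace.single 2 1⟫_ℝ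 = 0) → (∃ s < 0, ∃ y, fderiv ℝ (v s) y (EuclideanSpace.single 0 1) 2 ≠ 0) → (∀ s : ℝ, s < 0 → ∀ Φ : EuclideanSpace ℝ (Fin 3) → ℝ, ContDiff ℝ 2 Φ → (∀ y, v s y 0 = fderiv ℝ Φ y (EuclideanSpace.single 0 1) ∧ v s y 1 = fderiv ℝ Φ y (EuclideanSpace.single 1 1)) → ∀ y₀ : EuclideanSpace ℝ (Fin 3), (¬ ∀ᶠ y in nhdsWithin y₀ {y | y 2 = y₀ 2 ∧ y ≠ y₀}, v s y₀ 2 - fderiv ℝ Φ y₀ (EuclideanSpace.single 2 1) < v s y 2 - fderiv ℝ Φ y (EuclideanSpace.single 2 1)) ∧ (¬ ∀ᶠ y in nhdsWithin y₀ {y | y 2 = y₀ 2 ∧ y ≠ y₀}, v s y 2 - fderiv ℝ Φ y (EuclideanSpace.single 2 1) < v s y₀ 2 - fderiv ℝ Φ y₀ (EuclideanSpace.single 2 1))) →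
      (∀ (s z₀ σ M : ℝ) (K O : Set (EuclideanSpace ℝ (Fin 3))), s < 0 →
          ((σ = 1 ∨ σ = -1) ∧ IsCompact K ∧ K.Nonempty ∧ (∀ y ∈ K, y 2 = z₀ ∧ σ * v s y 2 = M) ∧
            IsOpen O ∧ K ⊆ O ∧ (∀ y ∈ O, y 2 = z₀ → σ * v s y 2 ≤ M) ∧
            (∀ y ∈ O, y 2 = z₀ → σ * v s y 2 = M → y ∈ K)) → False) →
      ¬ Literature.Analysis.FluidPDE.IsBackwardSingularPoint v 0) :
    Summit.NavierStokesRegularity.NavierStokesRegularity.Theses.LoopPeriodRatchet.PlanarExtremumLiouville := by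
  intro C v hrate hcont hmild hdiv hpol hfro hnf hnoext
  by_cases h2 : ∃ (s z₀ σ M : ℝ) (K O : Set (EuclideanSpace ℝ (Fin 3))), s < 0 ∧
      ((σ = 1 ∨ σ = -1) ∧ IsCompact K ∧ K.Nonempty ∧ (∀ y ∈ K, y 2 = z₀ ∧ σ * v s y 2 = M) ∧
            IsOpen O ∧ K ⊆ O ∧ (∀ y ∈ O, y 2 = z₀ → σ * v s y 2 ≤ M) ∧
            (∀ y ∈ O, y 2 = z₀ → σ * v s y 2 = M → y ∈ K))
  · obtain ⟨s₀, z₁, σ, M, K, O, hs₀, hisl⟩ := h2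
    have hz := zero_of_island hG C v hrate hcont hmild hdiv hpol s₀ z₁ σ M K O hs₀ hisl
    obtain ⟨s, hs, y, hy⟩ := hnf
    have hvs : v s = fun _ => 0 := funext (hz s hs)
    exact (hy (by rw [hvs]; simp)).elim
  · exact hPL C v hrate hcont hmild hdiv hpol hfro hnf hnoext
      (fun s z₀ σ M K O hs hisl => h2 ⟨s, z₀, σ, M, K, O, hs, hisl⟩)

/-- **S3 `stub_threadedThickEmpty` (twist_split v5 / far_thread v4, VERBATIM statement)**: if island data exist anywhere (any time, plane, sign, level),
`nullWindow_of_island` (landed HP3′ + landed HP1 + wall S6G by name) gives a window of dead planes and the LANDED pinned null rigidity (p664456) closes `False`;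
otherwise the profile is peakless and HL3′ applies.  v4.2: on this path NO provable stub is left — only S6G (item 27893) and the residue HL3′.  Kernel-checked. -/
theorem threadedThickEmpty_of_hotLoops :
    ∀ (C : ℝ) (v : ℝ → EuclideanSpace ℝ (Fin 3) → EuclideanSpace ℝ (Fin 3)),
      Literature.Analysis.FluidPDE.HasTypeITimeDecay C v →
      ContinuousOn (Function.uncurry v) (Set.Iio (0 : ℝ) ×ˢ Set.univ) →
      (∀ s t : ℝ, s < t → t < 0 → ∀ x, v t x =
        Literature.Analysis.UnboundedOperators.heatExtension (v s) (t - s) x -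
          Literature.Analysis.FluidPDE.oseenDuhamel 1 s v v t x) →
      (∀ t < 0, Literature.Analysis.FluidPDE.VectorCalculus.IsDivFree (v t)) →
      (∀ s < 0, ∀ y, ⟪Literature.Analysis.FluidPDE.curl (v s) y, EuclideanSpace.single 2 1⟫_ℝ = 0) →
      v (-1) 0 2 ≠ 0 → (∀ t < 0, ∀ x, Real.sqrt (-t) * |v t x 2| ≤ |v (-1) 0 2|) →
      (∀ h : EuclideanSpace ℝ (Fin 3), fderiv ℝ (v (-1)) 0 h 2 = 0) →
      (deriv (fun s => v s 0 2) (-1) = v (-1) 0 2 / 2 ∧ v (-1) 0 2 * (Δ (fun y => v (-1) y 2)) 0 ≤ 0) →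
      ∀ W : Set (ℝ × EuclideanSpace ℝ (Fin 3)), IsOpen W → W ⊆ Set.Iio (0 : ℝ) ×ˢ Set.univ →
        (∀ z ∈ W, (Literature.Analysis.FluidPDE.curl (v z.1) z.2 ≠ 0 ∧
            (fderiv ℝ (v z.1) z.2 (EuclideanSpace.single 0 1) 2 ≠ 0 ∨ fderiv ℝ (v z.1) z.2 (EuclideanSpace.single 1 1) 2 ≠ 0) ∧
            (fderiv ℝ (v z.1) z.2 (EuclideanSpace.single 2 1) 0 ≠ 0 ∨ fderiv ℝ (v z.1) z.2 (EuclideanSpace.single 2 1) 1 ≠ 0)) ∧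
          (fderiv ℝ (fun x => fderiv ℝ (v z.1) x (EuclideanSpace.single 2 1) 2) z.2 (EuclideanSpace.single 0 1) *
                fderiv ℝ (v z.1) z.2 (EuclideanSpace.single 1 1) 2 -
              fderiv ℝ (fun x => fderiv ℝ (v z.1) x (EuclideanSpace.single 2 1) 2) z.2 (EuclideanSpace.single 1 1) *
                fderiv ℝ (v z.1) z.2 (EuclideanSpace.single 0 1) 2 ≠ 0)) →
        (∀ m : ℝ → ℝ → ℝ, ∀ W₁ : Set (ℝ × EuclideanSpace ℝ (Fin 3)), W₁ ⊆ W → IsOpen W₁ → W₁.Nonempty →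
            ∃ z ∈ W₁, ∃ b : Fin 3, b ≠ 2 ∧
              fderiv ℝ (v z.1) z.2 (EuclideanSpace.single 2 1) b ≠
                m z.1 (z.2 2) * fderiv ℝ (v z.1) z.2 (EuclideanSpace.single b 1) 2) →
        (∀ r : ℝ, 0 < r → (Metric.ball ((-1 : ℝ), (0 : EuclideanSpace ℝ (Fin 3))) r ∩ W).Nonempty) →
        False := by
  intro C v hrate hcont hmild hdiv hpol hV hsup hgrad hpins W hWo hWs hW hnTH hacc
  by_cases h2 : ∃ (s z₀ σ M : ℝ) (K O : Set (EuclideanSpace ℝ (Fin 3))), s < 0 ∧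
      ((σ = 1 ∨ σ = -1) ∧ IsCompact K ∧ K.Nonempty ∧ (∀ y ∈ K, y 2 = z₀ ∧ σ * v s y 2 = M) ∧
            IsOpen O ∧ K ⊆ O ∧ (∀ y ∈ O, y 2 = z₀ → σ * v s y 2 ≤ M) ∧
            (∀ y ∈ O, y 2 = z₀ → σ * v s y 2 = M → y ∈ K))
  · obtain ⟨s₀, z₁, σ, M, K, O, hs₀, hisl⟩ := h2
    exact nullRigidityPinned C v hrate hcont hmild hdiv hpol hV hsup
      (nullWindow_of_island stub_frequencyGrowthExponent C v hrate hcont hmild hdiv hpol s₀ z₁ σ M K O hs₀ hisl)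
  · exact stub_peaklessEmpty C v hrate hcont hmild hdiv hpol hV hsup hgrad hpins W hWo hWs hW hnTH hacc
      (fun s z₀ σ M K O hs hisl => h2 ⟨s, z₀, σ, M, K, O, hs, hisl⟩)

/-- **The item `LrcModEntire` (stmt-NavierStokesRegularity-20428) BY NAME** — tree p633507 `…FarThreadReduction.lrcModEntire_of_NUGRS_of_threadedThick`. -/
theorem LrcModEntire_of_hotLoops :
    Summit.NavierStokesRegularity.NavierStokesRegularity.Theses.PoloidalWindowDoor.LrcModEntire :=
  lrcModEntire_of_NUGRS_of_threadedThick stub_localTHEmptyHypNUGRS threadedThickEmpty_of_hotLoops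

/-- **The crux `PoloidalWindowRigidity` (K2, stmt-NavierStokesRegularity-19708) BY NAME** — tree `…FarThreadReduction.poloidalWindowRigidity_of_TH_of_threadedThick`
with the (TH)∩twisting germ statement from the shared v4.3 local stub through the tree chain, and the composed S3. -/
theorem PoloidalWindowRigidity_of_hotLoops :
    Summit.NavierStokesRegularity.NavierStokesRegularity.Theses.PoloidalWindowDoor.PoloidalWindowRigidity :=
  poloidalWindowRigidity_of_TH_of_threadedThick
    (stub_twistingTH_of_localEmptyHyp
      (localTHEmptyHyp_of_localTHEmptyHypNonUmbilic
        (localTHEmptyHypNonUmbilic_of_galilean (localTHEmptyHypNF_of_normalFormRS stub_localTHEmptyHypNUGRS))))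
    threadedThickEmpty_of_hotLoops

end Summit.NavierStokesRegularity.NavierStokesRegularity.Cruxes.PoloidalWindowRigidity.HotLoops
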